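/-
Copyright: cell `pub-balaban-gaps` seat ne6 (gen 10) for the b2b-balaban T⁴-continuum CRUX team, row NE7b. Project licence.
-/
import Summits.QuantumFields.BalabanUV.T4Continuum.Spine.NE7b.GaussianInducedMeanDecay
import Literature.LinearAlgebra.Matrix.VarahBound

/-!
# THE INDUCED MEAN NEVER EXCEEDS THE FAR WINDOW for a row-dominant form: the maximum-principle clause of (R1′c) in MODEL form,
# fed from the tree's Varah bound, and the window-nesting letters `μ_b` it yields (row NE7b, node U5c)

Cell `pub-balaban-gaps` (G2 seat ne6 = row NE7b) for `pub-balaban/t4`, spine estimate NE7b (`T4WeightBudget.RelWeightBound`; the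
cell's OWN estimate — NOT PRINTED in [Bałaban 1983–89], NOT PROVED).  [folklore] finite sums over the OWNER lineage `t4-ne7b-p1`'s
kernel objects and ONE tree Literature theorem; NOTHING of Bałaban's is named, valued or asserted; no `Support` leaf; zero `sorry`.

WHY.  `…NE7b.GaussianInducedMeanDecay` (this seat, census V15) discharged the OWNER's displayed `hB` by decay + buffer and typed the
nesting lemma `translatedMass_le`, whose letters `μ_b ≥ mᵀQ_bm` it could only bound WITHOUT decay by `q_b·#Z_b·(C·V·#D)²`
(`windowEnergy_le_of_decay`) — useless against thresholds when `C·#D` is large.  The crux refuter's v69 names the missing clause: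
(R1′c) WINDOW «needs `|m_b| ≤ ‖S₁₁⁻¹S₁₂‖_{∞→∞}·p < p` = an M-matrix ∕ maximum-principle clause on `S`, not automatic for general PD
`S`».  THIS FILE types that clause in the model where it holds by ROW DOMINANCE: if every near row has a positive margin
`α_i ≤ |S i i| − Σ_{k≠i}|S i k|` and the coupling's row mass is within it, `Σ_a|S₁₂ i a| ≤ θ·α_i`, then the induced mean of ANY far
field `|x₂| ≤ p` satisfies `|m_b| ≤ θ·p` at EVERY near index (no buffer, no decay) — Varah's bound `‖A⁻¹‖_∞ ≤ 1∕min margin`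
(tree: `Literature.LinearAlgebra.Matrix.Varah.mul_norm_le_norm_mulVec`) applied to the row-scaled form; `θ = 1` when the FULL
near-plus-coupling rows are dominant with a mass to spare (the discrete maximum principle for a massive lattice operator).

WHAT IS PROVED ([folklore]):
* §1 `isUnit_det_of_rowMargin`, `scaledRow_margin`, **`abs_inv_mulVec_le_of_rowMargin`** (`0 < α_i`, `α_i + Σ_{k≠i}|S i k| ≤ |S i i|`,
  `|v_i| ≤ ρ·α_i` ⊢ `|(S⁻¹v) b| ≤ ρ` for every `b`).
* §2 `abs_coupling_le_rowSum` (`|(S₁₂x₂) i| ≤ p·Σ_a|S₁₂ i a|`), **`abs_inducedMean_le_window`** (`Σ_a|S₁₂ i a| ≤ θ·α_i` ⊢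
  `|m_b| ≤ θ·p`), **`abs_inducedMean_le_farWindow`** (FULL-row dominance with mass `α₀ > 0`:
  `α₀ + Σ_{k≠i}|S i k| + Σ_a|S₁₂ i a| ≤ S i i` ⊢ `|m_b| ≤ p` — the induced mean stays inside the far window).
* §3 **`windowEnergy_le_of_rowMargin`** (`μ_b := q_b·#Z_b·(θp)²` via V15's `qf_le_card_mul_sq`) and
  **`translatedMass_le_of_rowMargin`** (V15's `translatedMass_le` — itself the alias of the OWNER's `GaussianTranslatedMass.translatedLargeFieldMass_le` — at these letters: the OWNER's `hmass` shape with thresholds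
  `(θ_b − (1+ε⁻¹)·q_b·#Z_b·(θp)²)∕(1+ε)` — small against `θ_b` iff the window form's mass `q_b·#Z_b·p²` is, the MODEL reading of
  print's «small field» nesting).
* §4 a toy (`S = 2·1` on two sites, `α = 1`: §1's hypotheses jointly inhabited and the bound attained up to the factor 2).
NOT HERE (honest): Bałaban's fluctuation forms are covariant VECTOR Laplacians plus `aQ*Q` — not row-dominant M-matrices in general;
print controls the response by random-walk expansions ([Balaban1989LargeFieldI] §1) — that its letters SUPPLY `α_i, θ` is the (A1c)
INSTANCE (NC-NE7b-α UNRULED), not claimed; (R2); anything of Bałaban's.  BY-NAME EFFECT ON THE WALL: NONE.  NE7b NOT PRINTED ∕ NOT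
PROVED; spine PROVED 0∕9; rung (B)+1 on ONE finite T⁴ — NOT infinite volume, NOT the mass gap, NOT Clay.
HONEST DEPENDENCY: continuum YM on T⁴ ⇐ BetaPertH ∧ nine spine estimates (0∕9 proved); BetaPertH ⇐ (D1) ∧ (D4) ∧ CAP+tail; G-an2-4 gates asym, D1
and NE2∕3∕4.
-/

set_option autoImplicit false

open Matrix Finset MeasureTheory Real
open Summit.QuantumFields.BalabanUV.T4Continuum.NE7b.GaussianInducedMeanDecay

namespace Summit.QuantumFields.BalabanUV.T4Continuum.NE7b.GaussianInducedMeanWindow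

variable {n : Type*} [Fintype n] [DecidableEq n]

/-! ## §1 Row margins ⟹ the induced mean is bounded by the scaled data (Varah ∕ discrete maximum principle) -/

/-- Positive row margins make `S` strictly diagonally dominant, hence invertible (Levy–Desplanques, Mathlib). [folklore] -/
theorem isUnit_det_of_rowMargin {S : Matrix n n ℝ} (α : n → ℝ) (hα : ∀ i, 0 < α i)
    (hmar : ∀ i, α i + ∑ k ∈ univ.erase i, |S i k| ≤ |S i i|) : IsUnit S.det :=
  isUnit_iff_ne_zero.2 (det_ne_zero_of_sum_row_lt_diag fun i => by
    have h := hmar i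
    have e : ∑ k ∈ univ.erase i, ‖S i k‖ = ∑ k ∈ univ.erase i, |S i k| := rfl
    rw [e, Real.norm_eq_abs]
    linarith [hα i])

/-- The ROW-SCALED form `A i k = α_i⁻¹·S i k` has margin one in every row. [folklore] -/
theorem scaledRow_margin {S : Matrix n n ℝ} (α : n → ℝ) (hα : ∀ i, 0 < α i)
    (hmar : ∀ i, α i + ∑ k ∈ univ.erase i, |S i k| ≤ |S i i|) (i : n) :
    1 + ∑ k ∈ univ.erase i, ‖(Matrix.of fun i k => (α i)⁻¹ * S i k) i k‖ ≤
      ‖(Matrix.of fun i k => (α i)⁻¹ * S i k) i i‖ := by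
  have hαi := hα i
  simp only [Matrix.of_apply, Real.norm_eq_abs, abs_mul, abs_inv, abs_of_pos hαi]
  rw [← Finset.mul_sum]
  have h := mul_le_mul_of_nonneg_left (hmar i) (inv_nonneg.2 hαi.le)
  rw [mul_add, inv_mul_cancel₀ hαi.ne'] at h
  exact h

/-- **THE INDUCED MEAN UNDER ROW MARGINS** (Varah's bound at row-wise margins ∕ the discrete maximum principle): if every row of
`S` has a positive margin `α_i` (`α_i + Σ_{k≠i}|S i k| ≤ |S i i|`) and the data are within the margins, `|v_i| ≤ ρ·α_i`, then
`|(S⁻¹v) b| ≤ ρ` at EVERY index `b`. [folklore; Varah 1975 via the tree's `Literature.LinearAlgebra.Matrix.Varah.mul_norm_le_norm_mulVec`] -/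
theorem abs_inv_mulVec_le_of_rowMargin {S : Matrix n n ℝ} (α : n → ℝ) (hα : ∀ i, 0 < α i)
    (hmar : ∀ i, α i + ∑ k ∈ univ.erase i, |S i k| ≤ |S i i|) (v : n → ℝ) {ρ : ℝ} (hρ : 0 ≤ ρ)
    (hv : ∀ i, |v i| ≤ ρ * α i) (b : n) : |(S⁻¹ *ᵥ v) b| ≤ ρ := by
  set A : Matrix n n ℝ := Matrix.of fun i k => (α i)⁻¹ * S i k with hA
  set w : n → ℝ := S⁻¹ *ᵥ v with hw
  have hdet : IsUnit S.det := isUnit_det_of_rowMargin α hα hmar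
  have hSw : S *ᵥ w = v := by rw [hw, Matrix.mulVec_mulVec, Matrix.mul_nonsing_inv _ hdet, Matrix.one_mulVec]
  have hAw : A *ᵥ w = fun i => (α i)⁻¹ * v i := by
    ext i
    have : (A *ᵥ w) i = (α i)⁻¹ * (S *ᵥ w) i := by
      simp only [hA, Matrix.mulVec, dotProduct, Matrix.of_apply, Finset.mul_sum, mul_assoc]
    rw [this, hSw]
  have h1 : 1 * ‖w‖ ≤ ‖A *ᵥ w‖ :=
    Literature.LinearAlgebra.Matrix.Varah.mul_norm_le_norm_mulVec (A := A) (δ := 1) (scaledRow_margin α hα hmar) w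
  have h2 : ‖A *ᵥ w‖ ≤ ρ := by
    rw [hAw]
    refine (pi_norm_le_iff_of_nonneg hρ).2 fun i => ?_
    rw [Real.norm_eq_abs, abs_mul, abs_inv, abs_of_pos (hα i)]
    calc (α i)⁻¹ * |v i| ≤ (α i)⁻¹ * (ρ * α i) := mul_le_mul_of_nonneg_left (hv i) (inv_nonneg.2 (hα i).le)
      _ = ρ := by rw [mul_comm ρ, ← mul_assoc, inv_mul_cancel₀ (hα i).ne', one_mul]
  calc |w b| = ‖w b‖ := (Real.norm_eq_abs _).symm
    _ ≤ ‖w‖ := norm_le_pi_norm w b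
    _ ≤ ρ := by linarith

/-! ## §2 The reading: coupling mass within the margins ⟹ the induced mean stays inside the (scaled) far window -/

section Coupling
variable {m : Type*} [Fintype m]

omit [Fintype n] [DecidableEq n] in
/-- Row-wise size of the exterior term: `|(S₁₂x₂) i| ≤ p·Σ_a |S₁₂ i a|` for a far field `≤ p` on the coupling's column support. [folklore] -/
theorem abs_coupling_le_rowSum (S₁₂ : Matrix n m ℝ) (N : Finset m) (hcol : ∀ l a, S₁₂ l a ≠ 0 → a ∈ N)
    (x₂ : m → ℝ) {p : ℝ} (hx : ∀ a ∈ N, |x₂ a| ≤ p) (i : n) :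
    |(S₁₂ *ᵥ x₂) i| ≤ p * ∑ a, |S₁₂ i a| := by
  rw [Matrix.mulVec, dotProduct, Finset.mul_sum]
  refine (Finset.abs_sum_le_sum_abs _ _).trans (Finset.sum_le_sum fun a _ => ?_)
  rw [abs_mul, mul_comm p]
  by_cases h : S₁₂ i a = 0
  · rw [h, abs_zero, zero_mul, zero_mul]
  · exact mul_le_mul_of_nonneg_left (hx a (hcol i a h)) (abs_nonneg _)

/-- **THE INDUCED MEAN STAYS INSIDE THE SCALED WINDOW**: row margins `α_i > 0` on `S`, coupling row mass `Σ_a|S₁₂ i a| ≤ θ·α_i`,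
far field `|x₂| ≤ p` on the coupling's column support ⟹ `|(S⁻¹S₁₂x₂) b| ≤ θ·p` at every near index `b` — σ-2's nesting letter,
uniformly in `b` (no buffer). [folklore] -/
theorem abs_inducedMean_le_window {S : Matrix n n ℝ} (α : n → ℝ) (hα : ∀ i, 0 < α i)
    (hmar : ∀ i, α i + ∑ k ∈ univ.erase i, |S i k| ≤ |S i i|) (S₁₂ : Matrix n m ℝ) (N : Finset m)
    (hcol : ∀ l a, S₁₂ l a ≠ 0 → a ∈ N) (x₂ : m → ℝ) {p θ : ℝ} (hp : 0 ≤ p) (hθ : 0 ≤ θ)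
    (hx : ∀ a ∈ N, |x₂ a| ≤ p) (hs : ∀ i, ∑ a, |S₁₂ i a| ≤ θ * α i) (b : n) :
    |(S⁻¹ *ᵥ (S₁₂ *ᵥ x₂)) b| ≤ θ * p :=
  abs_inv_mulVec_le_of_rowMargin α hα hmar _ (mul_nonneg hθ hp) (fun i =>
    (abs_coupling_le_rowSum S₁₂ N hcol x₂ hx i).trans (by
      calc p * ∑ a, |S₁₂ i a| ≤ p * (θ * α i) := mul_le_mul_of_nonneg_left (hs i) hp
        _ = θ * p * α i := by ring)) b

/-- **THE DISCRETE MAXIMUM PRINCIPLE FOR A MASSIVE ROW-DOMINANT FULL FORM**: if every near row dominates its near AND far couplings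
with a mass `α₀ > 0` to spare, `α₀ + Σ_{k≠i}|S i k| + Σ_a|S₁₂ i a| ≤ S i i`, then the induced mean of a far field `|x₂| ≤ p` satisfies
`|m_b| ≤ p` at every near index: it never leaves the far window. [folklore] -/
theorem abs_inducedMean_le_farWindow {S : Matrix n n ℝ} (S₁₂ : Matrix n m ℝ) {α₀ : ℝ} (hα₀ : 0 < α₀)
    (hdom : ∀ i, α₀ + ∑ k ∈ univ.erase i, |S i k| + ∑ a, |S₁₂ i a| ≤ S i i) (N : Finset m)
    (hcol : ∀ l a, S₁₂ l a ≠ 0 → a ∈ N) (x₂ : m → ℝ) {p : ℝ} (hp : 0 ≤ p) (hx : ∀ a ∈ N, |x₂ a| ≤ p) (b : n) :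
    |(S⁻¹ *ᵥ (S₁₂ *ᵥ x₂)) b| ≤ p := by
  have hsum0 : ∀ i, 0 ≤ ∑ a, |S₁₂ i a| := fun i => Finset.sum_nonneg fun a _ => abs_nonneg _
  have hsum1 : ∀ i, 0 ≤ ∑ k ∈ univ.erase i, |S i k| := fun i => Finset.sum_nonneg fun k _ => abs_nonneg _
  -- margins `α_i := S i i − Σ_{k≠i}|S i k|` (≥ α₀ + coupling mass > 0)
  have key := abs_inducedMean_le_window (S := S) (fun i => S i i - ∑ k ∈ univ.erase i, |S i k|)
    (fun i => by linarith [hdom i, hsum0 i]) (fun i => by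
      have hSii : 0 ≤ S i i := by linarith [hdom i, hsum0 i, hsum1 i]
      rw [abs_of_nonneg hSii]; linarith) S₁₂ N hcol x₂ hp zero_le_one hx
    (fun i => by linarith [hdom i]) b
  simpa only [one_mul] using key

end Coupling

/-! ## §3 The nesting letters and the translated mass under row margins (junction to V15's §6) -/

section Nesting
variable {m : Type*} [Fintype m]

/-- **THE NESTING LETTER OF A WINDOW FORM**: `Q_b` positive semidefinite living on `Z_b` with `Q_b ≤ q_b·1`; under the hypotheses of
`abs_inducedMean_le_window`, `mᵀQ_bm ≤ q_b·#Z_b·(θp)²` for `m = S⁻¹S₁₂x₂`. [folklore] -/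
theorem windowEnergy_le_of_rowMargin {S : Matrix n n ℝ} (α : n → ℝ) (hα : ∀ i, 0 < α i)
    (hmar : ∀ i, α i + ∑ k ∈ univ.erase i, |S i k| ≤ |S i i|) (S₁₂ : Matrix n m ℝ) (N : Finset m)
    (hcol : ∀ l a, S₁₂ l a ≠ 0 → a ∈ N) (x₂ : m → ℝ) {p θ : ℝ} (hp : 0 ≤ p) (hθ : 0 ≤ θ)
    (hx : ∀ a ∈ N, |x₂ a| ≤ p) (hs : ∀ i, ∑ a, |S₁₂ i a| ≤ θ * α i)
    {Qb : Matrix n n ℝ} (hQb : Qb.PosSemidef) (Zb : Finset n) (hQZ : ∀ i j, j ∉ Zb → Qb i j = 0) {qb : ℝ}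
    (hQq : (qb • (1 : Matrix n n ℝ) - Qb).PosSemidef) (hqb : 0 ≤ qb) :
    (S⁻¹ *ᵥ (S₁₂ *ᵥ x₂)) ⬝ᵥ (Qb *ᵥ (S⁻¹ *ᵥ (S₁₂ *ᵥ x₂))) ≤ qb * Zb.card * (θ * p) ^ 2 :=
  qf_le_card_mul_sq hQb Zb hQZ hQq hqb _ fun i _ =>
    abs_inducedMean_le_window α hα hmar S₁₂ N hcol x₂ hp hθ hx hs i

/-- **THE TRANSLATED LARGE-FIELD MASS UNDER ROW MARGINS** = V15's `translatedMass_le` with the nesting letters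
`μ_b := q_b·#Z_b·(θp)²` SUPPLIED by `windowEnergy_le_of_rowMargin`: the OWNER's `hmass` shape for the restriction translated by the
induced mean `m = S⁻¹S₁₂x₂`, at thresholds `(θ_b − (1+ε⁻¹)·q_b·#Z_b·(θp)²)∕(1+ε)`. [folklore] -/
theorem translatedMass_le_of_rowMargin {ι : Type*} (B : Finset ι) {S : Matrix n n ℝ} (hS : S.PosDef)
    (α : n → ℝ) (hα : ∀ i, 0 < α i) (hmar : ∀ i, α i + ∑ k ∈ univ.erase i, |S i k| ≤ |S i i|)
    (S₁₂ : Matrix n m ℝ) (N : Finset m) (hcol : ∀ l a, S₁₂ l a ≠ 0 → a ∈ N) (x₂ : m → ℝ) {p θ : ℝ}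
    (hp : 0 ≤ p) (hθ : 0 ≤ θ) (hx : ∀ a ∈ N, |x₂ a| ≤ p) (hs : ∀ i, ∑ a, |S₁₂ i a| ≤ θ * α i)
    (Qb : ι → Matrix n n ℝ) (θb : ι → ℝ) (rb : ι → ℕ) (Zb : ι → Finset n) (qb : ι → ℝ) {δ : ℝ}
    (hQ : ∀ b ∈ B, (Qb b).PosSemidef) (hdom : ∀ b ∈ B, (δ • S - Qb b).PosSemidef) (hδ0 : 0 ≤ δ) (hδ : δ < 1)
    (hr : ∀ b ∈ B, (Qb b).rank ≤ rb b) (hQZ : ∀ b ∈ B, ∀ i j, j ∉ Zb b → Qb b i j = 0)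
    (hQq : ∀ b ∈ B, (qb b • (1 : Matrix n n ℝ) - Qb b).PosSemidef) (hqb : ∀ b ∈ B, 0 ≤ qb b)
    {F : (n → ℝ) → ℝ} (hF1 : ∀ x, F x ≤ 1)
    (hcov : ∀ x, 1 - F x ≤ ∑ b ∈ B, Set.indicator {x | θb b ≤ x ⬝ᵥ (Qb b *ᵥ x)} (fun _ => (1 : ℝ)) x)
    {ε : ℝ} (hε : 0 < ε) :
    ∫ u, (1 - F (u - S⁻¹ *ᵥ (S₁₂ *ᵥ x₂))) * exp (-(u ⬝ᵥ (S *ᵥ u))) ≤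
      (∑ b ∈ B, exp (-((θb b - (1 + ε⁻¹) * (qb b * (Zb b).card * (θ * p) ^ 2)) / (1 + ε))) *
          (√(1 - δ))⁻¹ ^ rb b) * ∫ u, exp (-(u ⬝ᵥ (S *ᵥ u))) :=
  translatedMass_le B Qb θb (fun b => qb b * (Zb b).card * (θ * p) ^ 2) rb hS hQ hdom hδ0 hδ hr hF1 hcov _
    (fun b hb => windowEnergy_le_of_rowMargin α hα hmar S₁₂ N hcol x₂ hp hθ hx hs (hQ b hb) (Zb b) (hQZ b hb)
      (hQq b hb) (hqb b hb)) hε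

end Nesting

/-! ## §4 A toy: the §1 hypotheses are jointly inhabited -/

/-- TOY: `S = 2·1` on two sites with margins `α = 1`: any data `|v_i| ≤ ρ` give `|(S⁻¹v) b| ≤ ρ` (the truth is `ρ∕2`). [folklore] -/
example (v : Fin 2 → ℝ) (ρ : ℝ) (hρ : 0 ≤ ρ) (hv : ∀ i, |v i| ≤ ρ) (b : Fin 2) :
    |(((2 : ℝ) • (1 : Matrix (Fin 2) (Fin 2) ℝ))⁻¹ *ᵥ v) b| ≤ ρ :=
  abs_inv_mulVec_le_of_rowMargin (fun _ => 1) (fun _ => one_pos)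
    (fun i => by
      rw [Finset.sum_eq_zero (fun k hk => by
        rw [Finset.mem_erase] at hk
        simp [Matrix.smul_apply, Ne.symm hk.1])]
      simp [Matrix.smul_apply])
    v hρ (fun i => by simpa using hv i) b

end Summit.QuantumFields.BalabanUV.T4Continuum.NE7b.GaussianInducedMeanWindow
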